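import Literature.Geometry.Kaehler.ComplexTorusTranscendentalLatticeInvariance
import Literature.Geometry.Kaehler.ComplexTorusEllipticProductDecompositionsNonCM
import HarnessLib

/-!
# Decompositions of a product of two elliptic curves, IV: the Néron–Severi and transcendental lattices of the
# normal form `A_N = E_{Nτ} × E_τ` of Picard number `3` — `NS ≅ U ⊕ ⟨-2N⟩`, `T ≅ U ⊕ ⟨2N⟩`, Ma's (4.1)
# `N = ½ det NS_A = -½ det T_A` — transported to every torus `X ≅ A_N`, with Theorems 1.2 (2), 1.3 (2) in their
# printed form "`δ = 2^{τ(N)-1}`, `δ̃ = 2^{τ(N)}` where `2N = -det(T_A)`"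

Layer `Literature/Geometry/Kaehler`, namespace `Literature.Geometry.Kaehler.ComplexTorus`; lane `lit-hodgefound`
(Track 2 foundations library, Layer A1/A4), seat p18 gen 23, row g23-#1 (sequel of row g22-#1: FILE 1
`ComplexTorusEllipticProductDecompositionsNonIsogenous`, FILE 2 `ComplexTorusEllipticProductDecompositionsNonCM`,
FILE 3 `ComplexTorusEllipticProductDecompositionsPicardThree`, whose header records "the transcendental lattice of
`E_{Nτ} × E_τ` is not computed here" — it is computed HERE; this file imports FILE 2 only, so that FILE 3's normal
form `X ≅ A_N` for `ρ(X) = 3`, with `N` the minimal isogeny degree of Prop. 4.1, composes with §5 below in one line).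
THEOREMS ONLY — no definition, no named fact (D-0026; net Literature debt `0`).  Infrastructure reused: `transcendentalLattice`, `torusIntegral_wedge_two_two`,
`wedge_eq_zero_iff_six`, the frame `ShiodaMitani.enum` and `orientationSign_enum` (row g13-#1,
`ComplexTorusTranscendentalLatticeShiodaMitani`), the transport of `H²(ℤ) ⊃ NS, T` and `∫` along isomorphisms
(`IsIsomorphic.exists_transcendentalLattice_transport`, row g13-#3, `ComplexTorusTranscendentalLatticeInvariance`),
Lange's relation `mem_hodgeClasses_ellipticPair_iff` / `ellipticPair_relation` (p19), FILE 2's splitting lemma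
`eq_zero_of_mul_tau_of_forall_ne` and its counts `card_decompositions_natCast_mul`,
`card_decompositions_up_to_swap_natCast_mul`, `card_decompositions_up_to_swap_prod_self`.

## Source, VERBATIM

S. Ma, *Decompositions of an Abelian surface and quadratic forms*, Ann. Inst. Fourier **61** (2011) 717–743
[Ma2011DecompositionsAbelianSurface] (held text `paper:arxiv-0906.0412`, §1 = p0003, §2 = p0005, §4 = p0008):
* §1 (p0003): "let `T_A` be the transcendental lattice of `A`, which is the orthogonal complement of the
  Néron-Severi lattice in `H²(A, ℤ)`." "**Theorem 1.2.** Let `A` be a decomposable Abelian surface. Then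
  `2 ≤ ρ(A) ≤ 4` and … (2) When `ρ(A) = 3`, one has `δ(A) = 2^{τ(N)-1}` where `2N = -det(T_A)`."
  "**Theorem 1.3.** … (2) If `ρ(A) = 3`, then `δ̃(A) = 1` (`N = 1`), `2^{τ(N)}` (`N > 1`), where `2N = -det(T_A)`."
  ("For a natural number `n > 1`, let `τ(n)` be the number of the prime divisors of `n`. We put `τ(1) := 1`.")
* §2 (p0005): "The Néron-Severi (resp. transcendental) lattice of `A` is denoted by `NS_A` (resp. `T_A`). …
  For a curve `C ⊂ A` its class in `NS_A` is written as `[C]`."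
* §4.1 (p0008): "Let `A` be a decomposable Abelian surface with `ρ(A) = 3`. Then `NS_A ≃ U ⊕ ⟨-2N⟩` for some
  `N ∈ ℤ_{>0}`. This natural number `N` may be calculated by (4.1) `N = ½ det(NS_A) = -½ det(T_A)`. We also have
  the following. **Proposition 4.1.** Let `(E₁, E₂)` be a decomposition of `A`. Then
  `N = min{deg φ | φ : E₁ → E₂ isogeny}`. … *Proof.* Let `l ∈ NS_A` be a generator of the rank `1` lattice
  `(ℤ[E₁] + ℤ[E₂])^⊥ ∩ NS_A ≃ ⟨-2N⟩`. …" "**Proposition 4.2** (cf. [Ha]). Let `A` be a decomposable Abelian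
  surface with `ρ(A) = 3` and `det(T_A) = -2N`. Then `δ(A) = 2^{τ(N)-1}`."
T. Shioda, N. Mitani, LNM **412** (1974) [ShiodaMitani1974], §1 (1.5) (the cup product `H² × H² → H⁴ = ℤ` "with
respect to the natural orientation"), §2 (2.5) (`H²(X, ℤ) = ⋀²(L^*)`, basis `uⁱ ∧ uʲ`), §3 (3.6)–(3.9) (the frame
and "`u¹² ∧ u³⁴ = 1`"), as materialised in `ComplexTorusTranscendentalLatticeShiodaMitani`.
H. Lange (2023) [Lange2023AbelianVarietiesComplex], §1.3.4 Exercise (9) (the relation of an algebraic class of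
`E_τ × E_{τ'}`, `mem_hodgeClasses_ellipticPair_iff`).

## Dictionary

`A_N := E_{Nτ} × E_τ = prodPeriod (ellipticPeriod _) (ellipticPeriod _)` on `ℂ × ℂ` (`E_σ = ℂ/(ℤσ + ℤ)`), the
normal form of FILES 2–3, with the lattice frame `λ₁ = (Nτ,0)`, `λ₂ = (1,0)`, `λ₃ = (0,τ)`, `λ₄ = (0,1)`
enumerated by `ShiodaMitani.enum` and the coordinate forms `ε_{kl} = dx_k ∧ dx_l = coordForm _ k l` (written out,
no new definitions; in Shioda–Mitani's dual frame `u¹³ = ε₁₂`, `u⁴² = ε₃₄`, `u³⁴ = ε₃₁`, `u¹² = ε₂₄`, `u¹⁴ = ε₂₃`,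
`u²³ = ε₁₄`).  `H²(X, ℤ) = integralForms Φ 2`, `NS_X = S_X = integralHodgeClasses Φ 1` (`= NS(X)` by the integral
Lefschetz `(1,1)` theorem `integralHodgeClasses_one_eq_map_neronSeveriGroup`), `T_X = transcendentalLattice Φ`,
the cup product of `2`-classes is `∫_X x ∧ y = torusIntegral Φ e (x.wedge y)` (complex orientation; symmetric,
§4), `ρ(X) = finrank ℤ (neronSeveriGroup Φ)`; a decomposition of `X` is a period pair `(ω₁, ω₂)` with
`E_{ω₁} × E_{ω₂} ≅ X` (`IsIsomorphic`), the degree of an isogeny `ρ(A) : E → E′` is `Nat.card (ker ρ(A)) = |det A|`.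
A lattice "`≅ U ⊕ ⟨m⟩`" is rendered by an explicit `ℤ`-basis `(b₁, b₂, b₃)` with unique coefficients and Gram
values `b₁² = 0, b₁b₂ = 1, b₁b₃ = 0, b₂² = 0, b₂b₃ = 0, b₃² = m`; "`det`" of such a Gram matrix is `-m` (§3).

## Contents (all proved)

* §1 `NS_{A_N}` (`τ` without complex multiplication — `∀ p q : ℚ, τ² + pτ + q ≠ 0` — and `N ≥ 1`):
  **`apply_rel_of_mem_integralHodgeClasses_natCast_mul`** (an algebraic class has `s₁₃ = s₂₄ = 0`,
  `s₁₄ = -N s₂₃`), `eq_combination_of_mem_integralHodgeClasses_natCast_mul`,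
  `sub_natCast_smul_mem_integralHodgeClasses_natCast_mul` (Ma's `l = ε₂₃ - Nε₁₄ ∈ NS`),
  **`mem_integralHodgeClasses_natCast_mul_iff_exists`** (`NS_{A_N} = ℤε₁₂ ⊕ ℤε₃₄ ⊕ ℤ(ε₂₃ - Nε₁₄)`),
  `independent_neronSeveri_natCast_mul`, **`torusIntegral_gram_neronSeveri_natCast_mul`** (Gram `±(U ⊕ ⟨-2N⟩)`).
* §2 `T_{A_N}`: **`apply_rel_of_mem_transcendentalLattice_natCast_mul`** (`t₃₄ = t₁₂ = 0`, `t₁₄ = N t₂₃`),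
  `eq_combination_of_mem_transcendentalLattice_natCast_mul`, `mem_transcendentalLattice_natCast_mul`
  (`ε₃₁, ε₂₄, ε₂₃ + Nε₁₄ ∈ T`), **`mem_transcendentalLattice_natCast_mul_iff_exists`**
  (`T_{A_N} = ℤε₃₁ ⊕ ℤε₂₄ ⊕ ℤ(ε₂₃ + Nε₁₄)`), `independent_transcendental_natCast_mul`,
  **`torusIntegral_gram_transcendental_natCast_mul`** (Gram `±(U ⊕ ⟨2N⟩)`).
* §3 upper half plane (`orientationSign_enum = 1`): **`gram_neronSeveri_natCast_mul`** (`U ⊕ ⟨-2N⟩` exactly),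
  **`gram_transcendental_natCast_mul`** (`U ⊕ ⟨2N⟩` exactly), `det_gram_neronSeveri_transcendental`
  ((4.1): `det = 2N`, resp. `-2N`).
* §4 `torusIntegral_wedge_two_comm` (the cup product on `2`-classes of a surface is symmetric).
* §5 for EVERY two-dimensional torus `X ≅ A_N` (transport along `IsIsomorphic.exists_transcendentalLattice_transport`):
  **`neronSeveri_transcendental_gram_of_isIsomorphic_natCast_mul`** (`NS_X ≅ U ⊕ ⟨-2N⟩`, `T_X ≅ U ⊕ ⟨2N⟩` — §4.1
  with (4.1)) and **`card_decompositions_of_isIsomorphic_natCast_mul_transcendentalLattice`** (THM. 1.3 (2) AND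
  THM. 1.2 (2) in printed form: `T_X ≅ U ⊕ ⟨2N⟩` and, for THIS `N`, `δ̃(X) = 2^{#primeFactors N}`,
  `δ(X) = 2^{#primeFactors N - 1}`).  For a decomposable `X` with `ρ(X) = 3` apply these to FILE 3's
  `exists_normalForm_of_finrank_neronSeveriGroup_eq_three` (there `N = gd` is the minimal isogeny degree,
  `minimal_degree_of_isIsomorphic_natCast_mul` — Prop. 4.1).

## Honest scope — NOT here

`det T_X` is presented through an explicit basis with Gram matrix `U ⊕ ⟨2N⟩`; that the determinant of a Gram
matrix does not depend on the `ℤ`-basis (so that "`det(T_A)`" is intrinsic) is the standard fact, not re-proved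
here (the rank-`2` case is `exists_det_gram_of_two_bases` in `ComplexTorusTranscendentalLatticeInvariance`).
The identification of `ε₁₂, ε₃₄` with the curve classes `[E₂], [E₁]` (signs, Poincaré duality for sub-tori) is
not spelled out; Prop. 4.2's attribution to Hayashida [Ha] and §4.3 (Atkin–Lehner) are not formalised; the one-line
composition with FILE 3 (hypothesis `ρ(X) = 3` instead of `X ≅ A_N`) is left to a sequel importing both files.
-- TODO(general form): `rk T_X = 6 - ρ(X)` and signature `(2, 4 - ρ)` for every two-dimensional complex torus.

## References

* [Ma2011DecompositionsAbelianSurface] S. Ma, Ann. Inst. Fourier 61 (2011) 717–743 = arXiv:0906.0412: §1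
  Thm. 1.2 (2), Thm. 1.3 (2); §2; §4.1 (4.1), Prop. 4.1, Prop. 4.2.
* [ShiodaMitani1974] T. Shioda, N. Mitani, LNM 412 (1974) 259–287: §1 (1.5), §2 (2.5), §3 (3.6)–(3.9).
* [Lange2023AbelianVarietiesComplex] H. Lange (2023): §1.3.4 Exercise (9), §1.1.4 Prop. 1.1.20, §2.1.1
  Example 2.1.3, §7.3.3 Exercise (1).
* [HulekLaface2019PicardNumbersAV] K. Hulek, R. Laface (2019), §1, Cor. 2.3 (`ρ(E × E′) ∈ {2, 3, 4}`).
-/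

noncomputable section

open Module Complex

namespace Literature.Geometry.Kaehler

namespace ComplexTorus

open ShiodaMitani

/-! ## §1 The Néron–Severi lattice of `A_N = E_{Nτ} × E_τ`: `S_A = ℤε₁₂ ⊕ ℤε₃₄ ⊕ ℤ(ε₂₃ - Nε₁₄) ≅ U ⊕ ⟨-2N⟩` -/

section NormalForm

variable {τ : ℂ} (hτ : τ.im ≠ 0) {N : ℕ} (hNτ : ((N : ℂ) * τ).im ≠ 0)

/-- `Im(Nτ) ≠ 0` forces `N ≠ 0`. [folklore] -/
private theorem natCast_ne_zero_of_mul_im (hNτ : ((N : ℂ) * τ).im ≠ 0) : (N : ℚ) ≠ 0 := by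
  have hN : N ≠ 0 := by
    rintro rfl
    simp at hNτ
  exact_mod_cast hN

/-- A rational multiple of a `2`-form, as a complex multiple. [folklore] -/
private theorem qsmul_eq_cast_smul₄ (q : ℚ) (t : (ℂ × ℂ) [⋀^Fin 2]→L[ℝ] ℂ) : q • t = (q : ℂ) • t :=
  (Rat.cast_smul_eq_qsmul ℂ q t).symm

/-- An integer multiple of a `2`-form, as a complex multiple. [folklore] -/
private theorem zsmul_eq_cast_smul₄ (n : ℤ) (t : (ℂ × ℂ) [⋀^Fin 2]→L[ℝ] ℂ) : n • t = (n : ℂ) • t :=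
  (Int.cast_smul_eq_zsmul ℂ n t).symm

/-- **The relations of an algebraic cocycle of `A_N = E_{Nτ} × E_τ`, `τ` without complex multiplication**
(Lange's Exercise 1.3.4 (9) relation `s₁₃ - τ s₁₄ - Nτ s₂₃ + Nτ² s₂₄ = 0` for the frame
`λ₁ = (Nτ,0), λ₂ = (1,0), λ₃ = (0,τ), λ₄ = (0,1)`, `s_{kl} = s(λ_k, λ_l) ∈ ℤ`, split along `1, τ, τ²` because `τ`
satisfies no rational quadratic equation): **`s₁₃ = 0`, `s₂₄ = 0`, `s₁₄ = -N s₂₃`** — so `rk S_A = 3` with the free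
coordinates `s₁₂, s₃₄, s₂₃` (Ma: "`ρ(A) = 3`, `NS_A ≅ U ⊕ ⟨-2N⟩`").
[cite: Ma2011DecompositionsAbelianSurface, §4.1 (before Prop. 4.1)] [cite: Lange2023AbelianVarietiesComplex, §1.3.4 Exercise (9)] -/
theorem apply_rel_of_mem_integralHodgeClasses_natCast_mul (hq : ∀ p q : ℚ, τ ^ 2 + p * τ + q ≠ 0)
    {s : (ℂ × ℂ) [⋀^Fin 2]→L[ℝ] ℂ}
    (hs : s ∈ integralHodgeClasses (prodPeriod (ellipticPeriod hNτ) (ellipticPeriod hτ)) 1) :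
    s ![prodPeriod (ellipticPeriod hNτ) (ellipticPeriod hτ) (Pi.single (Sum.inl 0) 1),
        prodPeriod (ellipticPeriod hNτ) (ellipticPeriod hτ) (Pi.single (Sum.inr 0) 1)] = 0 ∧
    s ![prodPeriod (ellipticPeriod hNτ) (ellipticPeriod hτ) (Pi.single (Sum.inl 1) 1),
        prodPeriod (ellipticPeriod hNτ) (ellipticPeriod hτ) (Pi.single (Sum.inr 1) 1)] = 0 ∧
    s ![prodPeriod (ellipticPeriod hNτ) (ellipticPeriod hτ) (Pi.single (Sum.inl 0) 1),
        prodPeriod (ellipticPeriod hNτ) (ellipticPeriod hτ) (Pi.single (Sum.inr 1) 1)] =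
      -(N : ℂ) * s ![prodPeriod (ellipticPeriod hNτ) (ellipticPeriod hτ) (Pi.single (Sum.inl 1) 1),
        prodPeriod (ellipticPeriod hNτ) (ellipticPeriod hτ) (Pi.single (Sum.inr 0) 1)] := by
  obtain ⟨hint, htype⟩ := (mem_integralHodgeClasses_iff _).1 hs
  have hrel := ellipticPair_relation (apply_I_smul_of_isOfTypeAt_one_one htype) ((N : ℂ) * τ) τ
  obtain ⟨n13, h13⟩ := exists_int_apply_single_of_mem_integralForms _ hint (Sum.inl 0) (Sum.inr 0)
  obtain ⟨n14, h14⟩ := exists_int_apply_single_of_mem_integralForms _ hint (Sum.inl 0) (Sum.inr 1)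
  obtain ⟨n23, h23⟩ := exists_int_apply_single_of_mem_integralForms _ hint (Sum.inl 1) (Sum.inr 0)
  obtain ⟨n24, h24⟩ := exists_int_apply_single_of_mem_integralForms _ hint (Sum.inl 1) (Sum.inr 1)
  rw [h13, h14, h23, h24]
  simp only [ellipticPair_single_inl_zero, ellipticPair_single_inl_one, ellipticPair_single_inr_zero,
    ellipticPair_single_inr_one] at h13 h14 h23 h24
  rw [h13, h14, h23, h24] at hrel
  have key : ((((N : ℚ) * n24 : ℚ) : ℂ) * τ + ((-(n14 + N * n23 : ℚ) : ℚ) : ℂ)) * τ =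
      ((0 : ℚ) : ℂ) * τ + ((-(n13 : ℚ) : ℚ) : ℂ) := by
    push_cast
    linear_combination hrel
  obtain ⟨h1, h2, h3⟩ := eq_zero_of_mul_tau_of_forall_ne hτ hq key
  have e24 : (n24 : ℚ) = 0 := (mul_eq_zero.1 h1).resolve_left (natCast_ne_zero_of_mul_im hNτ)
  have e13 : (n13 : ℚ) = 0 := by linarith
  have e14 : (n14 : ℚ) = -(N : ℚ) * n23 := by linarith
  refine ⟨by exact_mod_cast e13, by exact_mod_cast e24, by exact_mod_cast e14⟩

/-- **Every algebraic cocycle of `A_N` is the integer combination `s = s₁₂ ε₁₂ + s₃₄ ε₃₄ + s₂₃ (ε₂₃ - N ε₁₄)`**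
of its own lattice values (`ε_{kl} = dx_k ∧ dx_l`; in Shioda–Mitani's dual frame `u¹³ = ε₁₂`, `u⁴² = ε₃₄`,
`u¹⁴ = ε₂₃`, `u²³ = ε₁₄`: `S_A = ℤu¹³ ⊕ ℤu⁴² ⊕ ℤ(u¹⁴ - N u²³)`, Ma's `ℤ[E₁] + ℤ[E₂] + ℤl`).
[cite: Ma2011DecompositionsAbelianSurface, §4.1 (`NS_A ≅ U ⊕ ⟨-2N⟩`) and proof of Prop. 4.1] [cite: ShiodaMitani1974, §3 (3.8)] -/
theorem eq_combination_of_mem_integralHodgeClasses_natCast_mul (hq : ∀ p q : ℚ, τ ^ 2 + p * τ + q ≠ 0)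
    {s : (ℂ × ℂ) [⋀^Fin 2]→L[ℝ] ℂ}
    (hs : s ∈ integralHodgeClasses (prodPeriod (ellipticPeriod hNτ) (ellipticPeriod hτ)) 1) :
    s = s ![prodPeriod (ellipticPeriod hNτ) (ellipticPeriod hτ) (Pi.single (Sum.inl 0) 1),
            prodPeriod (ellipticPeriod hNτ) (ellipticPeriod hτ) (Pi.single (Sum.inl 1) 1)] •
          coordForm (prodPeriod (ellipticPeriod hNτ) (ellipticPeriod hτ)) (Sum.inl 0) (Sum.inl 1) +
        s ![prodPeriod (ellipticPeriod hNτ) (ellipticPeriod hτ) (Pi.single (Sum.inr 0) 1),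
            prodPeriod (ellipticPeriod hNτ) (ellipticPeriod hτ) (Pi.single (Sum.inr 1) 1)] •
          coordForm (prodPeriod (ellipticPeriod hNτ) (ellipticPeriod hτ)) (Sum.inr 0) (Sum.inr 1) +
        s ![prodPeriod (ellipticPeriod hNτ) (ellipticPeriod hτ) (Pi.single (Sum.inl 1) 1),
            prodPeriod (ellipticPeriod hNτ) (ellipticPeriod hτ) (Pi.single (Sum.inr 0) 1)] •
          (coordForm (prodPeriod (ellipticPeriod hNτ) (ellipticPeriod hτ)) (Sum.inl 1) (Sum.inr 0) -
            (N : ℂ) • coordForm (prodPeriod (ellipticPeriod hNτ) (ellipticPeriod hτ)) (Sum.inl 0) (Sum.inr 1)) := by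
  obtain ⟨h13, h24, h14⟩ := apply_rel_of_mem_integralHodgeClasses_natCast_mul hτ hNτ hq hs
  refine twoForm_eq_of_apply_single_eq_sum_fin_two (prodPeriod (ellipticPeriod hNτ) (ellipticPeriod hτ))
    ?_ ?_ ?_ ?_ ?_ ?_
  all_goals
    simp only [ContinuousAlternatingMap.add_apply, ContinuousAlternatingMap.sub_apply,
      ContinuousAlternatingMap.smul_apply, coordForm_apply_single, smul_eq_mul]
    simp only [reduceCtorEq, Sum.inl.injEq, Sum.inr.injEq, Fin.isValue, zero_ne_one, one_ne_zero,
      if_true, if_false]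
    push_cast
  · ring
  · rw [h13]; ring
  · rw [h14]; ring
  · ring
  · rw [h24]; ring
  · ring

/-- `ε₁₂` (a fibre class) is an algebraic cocycle of `E_{τ₁} × E_{τ₂}`. [cite: ShiodaMitani1974, §3 (3.8)] -/
private theorem coordForm_inl_inl_mem_integralHodgeClasses {τ₁ τ₂ : ℂ} (hτ₁ : τ₁.im ≠ 0) (hτ₂ : τ₂.im ≠ 0) :
    coordForm (prodPeriod (ellipticPeriod hτ₁) (ellipticPeriod hτ₂)) (Sum.inl 0) (Sum.inl 1) ∈
      integralHodgeClasses (prodPeriod (ellipticPeriod hτ₁) (ellipticPeriod hτ₂)) 1 :=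
  (mem_integralHodgeClasses_iff _).2 ⟨coordForm_mem_integralForms _ _ _, isOfTypeAt_coordForm_ellipticPair_inl_inl hτ₁ hτ₂⟩

/-- `ε₃₄` (a fibre class) is an algebraic cocycle of `E_{τ₁} × E_{τ₂}`. [cite: ShiodaMitani1974, §3 (3.8)] -/
private theorem coordForm_inr_inr_mem_integralHodgeClasses {τ₁ τ₂ : ℂ} (hτ₁ : τ₁.im ≠ 0) (hτ₂ : τ₂.im ≠ 0) :
    coordForm (prodPeriod (ellipticPeriod hτ₁) (ellipticPeriod hτ₂)) (Sum.inr 0) (Sum.inr 1) ∈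
      integralHodgeClasses (prodPeriod (ellipticPeriod hτ₁) (ellipticPeriod hτ₂)) 1 :=
  (mem_integralHodgeClasses_iff _).2 ⟨coordForm_mem_integralForms _ _ _, isOfTypeAt_coordForm_ellipticPair_inr_inr hτ₁ hτ₂⟩

/-- A natural-number multiple of a coordinate form is an integral class. [folklore] -/
private theorem natCast_smul_coordForm_mem_integralForms {τ₁ τ₂ : ℂ} (hτ₁ : τ₁.im ≠ 0) (hτ₂ : τ₂.im ≠ 0) (n : ℕ)
    (x y : Fin 2 ⊕ Fin 2) :
    (n : ℂ) • coordForm (prodPeriod (ellipticPeriod hτ₁) (ellipticPeriod hτ₂)) x y ∈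
      integralForms (prodPeriod (ellipticPeriod hτ₁) (ellipticPeriod hτ₂)) 2 := by
  rw [show (n : ℂ) = ((n : ℤ) : ℂ) from (Int.cast_natCast n).symm, ← zsmul_eq_cast_smul₄]
  exact AddSubgroup.zsmul_mem _ (coordForm_mem_integralForms _ x y) _

/-- **Ma's class `l = ε₂₃ - N ε₁₄` is an algebraic cocycle of `A_N = E_{Nτ} × E_τ`** (it satisfies Lange's
relation: `0 + Nτ - Nτ + 0 = 0`; up to fibre classes it is the graph class of the isogeny `z ↦ z : E_{Nτ} → E_τ`
of degree `N`), for ANY `τ ∉ ℝ`. [cite: Ma2011DecompositionsAbelianSurface, §4.1 proof of Prop. 4.1] [cite: Lange2023AbelianVarietiesComplex, §1.3.4 Exercise (9)] -/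
theorem sub_natCast_smul_mem_integralHodgeClasses_natCast_mul :
    coordForm (prodPeriod (ellipticPeriod hNτ) (ellipticPeriod hτ)) (Sum.inl 1) (Sum.inr 0) -
        (N : ℂ) • coordForm (prodPeriod (ellipticPeriod hNτ) (ellipticPeriod hτ)) (Sum.inl 0) (Sum.inr 1) ∈
      integralHodgeClasses (prodPeriod (ellipticPeriod hNτ) (ellipticPeriod hτ)) 1 := by
  refine (mem_integralHodgeClasses_iff _).2 ⟨(integralForms _ 2).sub_mem (coordForm_mem_integralForms _ _ _)
    (natCast_smul_coordForm_mem_integralForms hNτ hτ N _ _), ?_⟩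
  have hmem : coordForm (prodPeriod (ellipticPeriod hNτ) (ellipticPeriod hτ)) (Sum.inl 1) (Sum.inr 0) -
      (N : ℂ) • coordForm (prodPeriod (ellipticPeriod hNτ) (ellipticPeriod hτ)) (Sum.inl 0) (Sum.inr 1) ∈
        hodgeClasses (prodPeriod (ellipticPeriod hNτ) (ellipticPeriod hτ)) 1 := by
    refine (mem_hodgeClasses_ellipticPair_iff hNτ hτ).2 ⟨![0, 0, 0, (-N : ℚ), 1, 0], ?_, ?_⟩
    · simp only [Matrix.cons_val]
      push_cast
      ring
    · simp only [Fin.sum_univ_six, Matrix.cons_val_zero, Matrix.cons_val_one, Matrix.cons_val, qsmul_eq_cast_smul₄]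
      push_cast
      module
  exact ((mem_hodgeClasses_iff _).1 hmem).2

/-- **`S_{A_N} = ℤε₁₂ ⊕ ℤε₃₄ ⊕ ℤ(ε₂₃ - Nε₁₄)`** (`τ` without complex multiplication, `N ≥ 1`): the algebraic
cocycles of `A_N = E_{Nτ} × E_τ` are exactly the integer combinations of the two fibre classes and Ma's `l` —
"`NS_A ≅ U ⊕ ⟨-2N⟩`" with `U = ℤ[E₁] + ℤ[E₂]` and `l` a generator of `(ℤ[E₁] + ℤ[E₂])^⊥ ∩ NS_A`.
[cite: Ma2011DecompositionsAbelianSurface, §4.1 (before and in the proof of Prop. 4.1)] -/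
theorem mem_integralHodgeClasses_natCast_mul_iff_exists (hq : ∀ p q : ℚ, τ ^ 2 + p * τ + q ≠ 0)
    {s : (ℂ × ℂ) [⋀^Fin 2]→L[ℝ] ℂ} :
    s ∈ integralHodgeClasses (prodPeriod (ellipticPeriod hNτ) (ellipticPeriod hτ)) 1 ↔
      ∃ n₁ n₂ n₃ : ℤ, s = n₁ • coordForm (prodPeriod (ellipticPeriod hNτ) (ellipticPeriod hτ)) (Sum.inl 0) (Sum.inl 1) +
        n₂ • coordForm (prodPeriod (ellipticPeriod hNτ) (ellipticPeriod hτ)) (Sum.inr 0) (Sum.inr 1) +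
        n₃ • (coordForm (prodPeriod (ellipticPeriod hNτ) (ellipticPeriod hτ)) (Sum.inl 1) (Sum.inr 0) -
          (N : ℂ) • coordForm (prodPeriod (ellipticPeriod hNτ) (ellipticPeriod hτ)) (Sum.inl 0) (Sum.inr 1)) := by
  constructor
  · intro hs
    have hint := ((mem_integralHodgeClasses_iff _).1 hs).1
    obtain ⟨n₁, h₁⟩ := exists_int_apply_single_of_mem_integralForms _ hint (Sum.inl 0) (Sum.inl 1)
    obtain ⟨n₂, h₂⟩ := exists_int_apply_single_of_mem_integralForms _ hint (Sum.inr 0) (Sum.inr 1)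
    obtain ⟨n₃, h₃⟩ := exists_int_apply_single_of_mem_integralForms _ hint (Sum.inl 1) (Sum.inr 0)
    refine ⟨n₁, n₂, n₃, ?_⟩
    rw [zsmul_eq_cast_smul₄, zsmul_eq_cast_smul₄, zsmul_eq_cast_smul₄, ← h₁, ← h₂, ← h₃]
    exact eq_combination_of_mem_integralHodgeClasses_natCast_mul hτ hNτ hq hs
  · rintro ⟨n₁, n₂, n₃, rfl⟩
    exact (integralHodgeClasses _ 1).add_mem ((integralHodgeClasses _ 1).add_mem
      ((integralHodgeClasses _ 1).zsmul_mem (coordForm_inl_inl_mem_integralHodgeClasses hNτ hτ) _)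
      ((integralHodgeClasses _ 1).zsmul_mem (coordForm_inr_inr_mem_integralHodgeClasses hNτ hτ) _))
      ((integralHodgeClasses _ 1).zsmul_mem (sub_natCast_smul_mem_integralHodgeClasses_natCast_mul hτ hNτ) _)

/-- The coefficients in `S_{A_N} = ℤε₁₂ ⊕ ℤε₃₄ ⊕ ℤ(ε₂₃ - Nε₁₄)` are unique: the three classes are linearly
independent (test against `(λ₁,λ₂)`, `(λ₃,λ₄)`, `(λ₂,λ₃)`), so `rk S_{A_N} = 3 = ρ(A_N)`.
[cite: Ma2011DecompositionsAbelianSurface, §4.1] -/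
theorem independent_neronSeveri_natCast_mul {n₁ n₂ n₃ : ℂ}
    (h : n₁ • coordForm (prodPeriod (ellipticPeriod hNτ) (ellipticPeriod hτ)) (Sum.inl 0) (Sum.inl 1) +
        n₂ • coordForm (prodPeriod (ellipticPeriod hNτ) (ellipticPeriod hτ)) (Sum.inr 0) (Sum.inr 1) +
        n₃ • (coordForm (prodPeriod (ellipticPeriod hNτ) (ellipticPeriod hτ)) (Sum.inl 1) (Sum.inr 0) -
          (N : ℂ) • coordForm (prodPeriod (ellipticPeriod hNτ) (ellipticPeriod hτ)) (Sum.inl 0) (Sum.inr 1)) = 0) :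
    n₁ = 0 ∧ n₂ = 0 ∧ n₃ = 0 := by
  have ev := fun x y : Fin 2 ⊕ Fin 2 ↦ congrArg (fun δ : (ℂ × ℂ) [⋀^Fin 2]→L[ℝ] ℂ ↦
    δ ![prodPeriod (ellipticPeriod hNτ) (ellipticPeriod hτ) (Pi.single x 1),
        prodPeriod (ellipticPeriod hNτ) (ellipticPeriod hτ) (Pi.single y 1)]) h
  have e12 := ev (Sum.inl 0) (Sum.inl 1)
  have e34 := ev (Sum.inr 0) (Sum.inr 1)
  have e23 := ev (Sum.inl 1) (Sum.inr 0)
  simp only [ContinuousAlternatingMap.add_apply, ContinuousAlternatingMap.sub_apply,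
    ContinuousAlternatingMap.smul_apply, ContinuousAlternatingMap.coe_zero, Pi.zero_apply, coordForm_apply_single,
    smul_eq_mul] at e12 e34 e23
  simp only [reduceCtorEq, Sum.inl.injEq, Sum.inr.injEq, Fin.isValue, zero_ne_one, one_ne_zero,
    if_true, if_false] at e12 e34 e23
  push_cast at e12 e34 e23
  exact ⟨by linear_combination e12, by linear_combination e34, by linear_combination e23⟩

/-- **The Gram matrix of `(ε₁₂, ε₃₄, ε₂₃ - Nε₁₄)` is `±(U ⊕ ⟨-2N⟩)`**, the sign being the orientation sign of the
frame: `ε₁₂·ε₃₄ = ±1`, `(ε₂₃ - Nε₁₄)² = ∓2N`, all other products `0` (for ANY `τ ∉ ℝ`).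
[cite: Ma2011DecompositionsAbelianSurface, §4.1 (`NS_A ≅ U ⊕ ⟨-2N⟩`)] [cite: ShiodaMitani1974, §1 (1.5)] -/
theorem torusIntegral_gram_neronSeveri_natCast_mul :
    torusIntegral (prodPeriod (ellipticPeriod hNτ) (ellipticPeriod hτ)) enum
        ((coordForm (prodPeriod (ellipticPeriod hNτ) (ellipticPeriod hτ)) (Sum.inl 0) (Sum.inl 1)).wedge
          (coordForm (prodPeriod (ellipticPeriod hNτ) (ellipticPeriod hτ)) (Sum.inl 0) (Sum.inl 1))) = 0 ∧
      torusIntegral (prodPeriod (ellipticPeriod hNτ) (ellipticPeriod hτ)) enum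
        ((coordForm (prodPeriod (ellipticPeriod hNτ) (ellipticPeriod hτ)) (Sum.inl 0) (Sum.inl 1)).wedge
          (coordForm (prodPeriod (ellipticPeriod hNτ) (ellipticPeriod hτ)) (Sum.inr 0) (Sum.inr 1))) =
        orientationSign (prodPeriod (ellipticPeriod hNτ) (ellipticPeriod hτ)) enum ∧
      torusIntegral (prodPeriod (ellipticPeriod hNτ) (ellipticPeriod hτ)) enum
        ((coordForm (prodPeriod (ellipticPeriod hNτ) (ellipticPeriod hτ)) (Sum.inl 0) (Sum.inl 1)).wedge
          (coordForm (prodPeriod (ellipticPeriod hNτ) (ellipticPeriod hτ)) (Sum.inl 1) (Sum.inr 0) -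
            (N : ℂ) • coordForm (prodPeriod (ellipticPeriod hNτ) (ellipticPeriod hτ)) (Sum.inl 0) (Sum.inr 1))) = 0 ∧
      torusIntegral (prodPeriod (ellipticPeriod hNτ) (ellipticPeriod hτ)) enum
        ((coordForm (prodPeriod (ellipticPeriod hNτ) (ellipticPeriod hτ)) (Sum.inr 0) (Sum.inr 1)).wedge
          (coordForm (prodPeriod (ellipticPeriod hNτ) (ellipticPeriod hτ)) (Sum.inr 0) (Sum.inr 1))) = 0 ∧
      torusIntegral (prodPeriod (ellipticPeriod hNτ) (ellipticPeriod hτ)) enum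
        ((coordForm (prodPeriod (ellipticPeriod hNτ) (ellipticPeriod hτ)) (Sum.inr 0) (Sum.inr 1)).wedge
          (coordForm (prodPeriod (ellipticPeriod hNτ) (ellipticPeriod hτ)) (Sum.inl 1) (Sum.inr 0) -
            (N : ℂ) • coordForm (prodPeriod (ellipticPeriod hNτ) (ellipticPeriod hτ)) (Sum.inl 0) (Sum.inr 1))) = 0 ∧
      torusIntegral (prodPeriod (ellipticPeriod hNτ) (ellipticPeriod hτ)) enum
        ((coordForm (prodPeriod (ellipticPeriod hNτ) (ellipticPeriod hτ)) (Sum.inl 1) (Sum.inr 0) -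
            (N : ℂ) • coordForm (prodPeriod (ellipticPeriod hNτ) (ellipticPeriod hτ)) (Sum.inl 0) (Sum.inr 1)).wedge
          (coordForm (prodPeriod (ellipticPeriod hNτ) (ellipticPeriod hτ)) (Sum.inl 1) (Sum.inr 0) -
            (N : ℂ) • coordForm (prodPeriod (ellipticPeriod hNτ) (ellipticPeriod hτ)) (Sum.inl 0) (Sum.inr 1))) =
        -(orientationSign (prodPeriod (ellipticPeriod hNτ) (ellipticPeriod hτ)) enum * (2 * (N : ℂ))) := by
  refine ⟨?_, ?_, ?_, ?_, ?_, ?_⟩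
  all_goals
    rw [torusIntegral_wedge_two_two]
    simp only [enum_zero, enum_one, enum_two, enum_three, ContinuousAlternatingMap.sub_apply,
      ContinuousAlternatingMap.smul_apply, coordForm_apply_single, smul_eq_mul]
    simp only [reduceCtorEq, Sum.inl.injEq, Sum.inr.injEq, Fin.isValue, zero_ne_one, one_ne_zero,
      if_true, if_false]
    push_cast
    ring

/-! ## §2 The transcendental lattice of `A_N`: `T_A = ℤε₃₁ ⊕ ℤε₂₄ ⊕ ℤ(ε₂₃ + Nε₁₄) ≅ U ⊕ ⟨2N⟩`, `det T_A = -2N` -/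

/-- **The relations of a transcendental cocycle of `A_N = E_{Nτ} × E_τ`** (`τ` without complex multiplication):
testing `t ∈ T_A` against the algebraic classes `ε₁₂`, `ε₃₄`, `ε₂₃ - Nε₁₄` gives **`t₃₄ = 0`, `t₁₂ = 0`,
`t₁₄ = N t₂₃`** (`t_{kl} = t(λ_k, λ_l)`). [cite: Ma2011DecompositionsAbelianSurface, §4.1 (4.1) `N = -½ det T_A`] [cite: ShiodaMitani1974, §3 (3.9)] -/
theorem apply_rel_of_mem_transcendentalLattice_natCast_mul {t : (ℂ × ℂ) [⋀^Fin 2]→L[ℝ] ℂ}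
    (ht : t ∈ transcendentalLattice (prodPeriod (ellipticPeriod hNτ) (ellipticPeriod hτ))) :
    t ![prodPeriod (ellipticPeriod hNτ) (ellipticPeriod hτ) (Pi.single (Sum.inr 0) 1),
        prodPeriod (ellipticPeriod hNτ) (ellipticPeriod hτ) (Pi.single (Sum.inr 1) 1)] = 0 ∧
    t ![prodPeriod (ellipticPeriod hNτ) (ellipticPeriod hτ) (Pi.single (Sum.inl 0) 1),
        prodPeriod (ellipticPeriod hNτ) (ellipticPeriod hτ) (Pi.single (Sum.inl 1) 1)] = 0 ∧
    t ![prodPeriod (ellipticPeriod hNτ) (ellipticPeriod hτ) (Pi.single (Sum.inl 0) 1),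
        prodPeriod (ellipticPeriod hNτ) (ellipticPeriod hτ) (Pi.single (Sum.inr 1) 1)] =
      (N : ℂ) * t ![prodPeriod (ellipticPeriod hNτ) (ellipticPeriod hτ) (Pi.single (Sum.inl 1) 1),
        prodPeriod (ellipticPeriod hNτ) (ellipticPeriod hτ) (Pi.single (Sum.inr 0) 1)] := by
  have k1 := ht.2 _ (coordForm_inl_inl_mem_integralHodgeClasses hNτ hτ)
  have k2 := ht.2 _ (coordForm_inr_inr_mem_integralHodgeClasses hNτ hτ)
  have k3 := ht.2 _ (sub_natCast_smul_mem_integralHodgeClasses_natCast_mul hτ hNτ)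
  rw [wedge_eq_zero_iff_six (prodPeriod (ellipticPeriod hNτ) (ellipticPeriod hτ)) enum] at k1 k2 k3
  simp only [enum_zero, enum_one, enum_two, enum_three, ContinuousAlternatingMap.sub_apply,
    ContinuousAlternatingMap.smul_apply, coordForm_apply_single, smul_eq_mul] at k1 k2 k3
  simp only [reduceCtorEq, Sum.inl.injEq, Sum.inr.injEq, Fin.isValue, zero_ne_one, one_ne_zero,
    if_true, if_false] at k1 k2 k3
  push_cast at k1 k2 k3
  exact ⟨by linear_combination k1, by linear_combination k2, by linear_combination k3⟩

/-- **Every transcendental cocycle of `A_N` is `t = -t₁₃ ε₃₁ + t₂₄ ε₂₄ + t₂₃ (ε₂₃ + Nε₁₄)`** (in Shioda–Mitani's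
dual frame `u³⁴ = ε₃₁`, `u¹² = ε₂₄`, `u¹⁴ = ε₂₃`, `u²³ = ε₁₄`: `T_A = ℤu³⁴ ⊕ ℤu¹² ⊕ ℤ(u¹⁴ + N u²³)`).
[cite: Ma2011DecompositionsAbelianSurface, §4.1 (4.1)] [cite: ShiodaMitani1974, §3 (3.9)] -/
theorem eq_combination_of_mem_transcendentalLattice_natCast_mul {t : (ℂ × ℂ) [⋀^Fin 2]→L[ℝ] ℂ}
    (ht : t ∈ transcendentalLattice (prodPeriod (ellipticPeriod hNτ) (ellipticPeriod hτ))) :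
    t = (-t ![prodPeriod (ellipticPeriod hNτ) (ellipticPeriod hτ) (Pi.single (Sum.inl 0) 1),
            prodPeriod (ellipticPeriod hNτ) (ellipticPeriod hτ) (Pi.single (Sum.inr 0) 1)]) •
          coordForm (prodPeriod (ellipticPeriod hNτ) (ellipticPeriod hτ)) (Sum.inr 0) (Sum.inl 0) +
        t ![prodPeriod (ellipticPeriod hNτ) (ellipticPeriod hτ) (Pi.single (Sum.inl 1) 1),
            prodPeriod (ellipticPeriod hNτ) (ellipticPeriod hτ) (Pi.single (Sum.inr 1) 1)] •
          coordForm (prodPeriod (ellipticPeriod hNτ) (ellipticPeriod hτ)) (Sum.inl 1) (Sum.inr 1) +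
        t ![prodPeriod (ellipticPeriod hNτ) (ellipticPeriod hτ) (Pi.single (Sum.inl 1) 1),
            prodPeriod (ellipticPeriod hNτ) (ellipticPeriod hτ) (Pi.single (Sum.inr 0) 1)] •
          (coordForm (prodPeriod (ellipticPeriod hNτ) (ellipticPeriod hτ)) (Sum.inl 1) (Sum.inr 0) +
            (N : ℂ) • coordForm (prodPeriod (ellipticPeriod hNτ) (ellipticPeriod hτ)) (Sum.inl 0) (Sum.inr 1)) := by
  obtain ⟨k34, k12, k14⟩ := apply_rel_of_mem_transcendentalLattice_natCast_mul hτ hNτ ht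
  refine twoForm_eq_of_apply_single_eq_sum_fin_two (prodPeriod (ellipticPeriod hNτ) (ellipticPeriod hτ))
    ?_ ?_ ?_ ?_ ?_ ?_
  all_goals
    simp only [ContinuousAlternatingMap.add_apply, ContinuousAlternatingMap.smul_apply, coordForm_apply_single,
      smul_eq_mul]
    simp only [reduceCtorEq, Sum.inl.injEq, Sum.inr.injEq, Fin.isValue, zero_ne_one, one_ne_zero,
      if_true, if_false]
    push_cast
  · rw [k12]; ring
  · ring
  · rw [k14]; ring
  · ring
  · ring
  · rw [k34]; ring

/-- **`ε₃₁`, `ε₂₄` and `ε₂₃ + Nε₁₄` are transcendental cocycles of `A_N`** (`τ` without complex multiplication):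
against an algebraic `s` (relations `s₁₃ = s₂₄ = 0`, `s₁₄ = -N s₂₃`) the three cup products are `s₂₄`, `-s₁₃` and
`N s₂₃ + s₁₄`, all zero. [cite: Ma2011DecompositionsAbelianSurface, §4.1 (4.1)] [cite: ShiodaMitani1974, §3 (3.9)] -/
theorem mem_transcendentalLattice_natCast_mul (hq : ∀ p q : ℚ, τ ^ 2 + p * τ + q ≠ 0) :
    coordForm (prodPeriod (ellipticPeriod hNτ) (ellipticPeriod hτ)) (Sum.inr 0) (Sum.inl 0) ∈
        transcendentalLattice (prodPeriod (ellipticPeriod hNτ) (ellipticPeriod hτ)) ∧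
      coordForm (prodPeriod (ellipticPeriod hNτ) (ellipticPeriod hτ)) (Sum.inl 1) (Sum.inr 1) ∈
        transcendentalLattice (prodPeriod (ellipticPeriod hNτ) (ellipticPeriod hτ)) ∧
      coordForm (prodPeriod (ellipticPeriod hNτ) (ellipticPeriod hτ)) (Sum.inl 1) (Sum.inr 0) +
          (N : ℂ) • coordForm (prodPeriod (ellipticPeriod hNτ) (ellipticPeriod hτ)) (Sum.inl 0) (Sum.inr 1) ∈
        transcendentalLattice (prodPeriod (ellipticPeriod hNτ) (ellipticPeriod hτ)) := by
  refine ⟨⟨coordForm_mem_integralForms _ _ _, fun s hs ↦ ?_⟩, ⟨coordForm_mem_integralForms _ _ _, fun s hs ↦ ?_⟩,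
    ⟨(integralForms _ 2).add_mem (coordForm_mem_integralForms _ _ _)
      (natCast_smul_coordForm_mem_integralForms hNτ hτ N _ _), fun s hs ↦ ?_⟩⟩
  all_goals
    obtain ⟨h13, h24, h14⟩ := apply_rel_of_mem_integralHodgeClasses_natCast_mul hτ hNτ hq hs
    rw [wedge_eq_zero_iff_six (prodPeriod (ellipticPeriod hNτ) (ellipticPeriod hτ)) enum]
    simp only [enum_zero, enum_one, enum_two, enum_three, ContinuousAlternatingMap.add_apply,
      ContinuousAlternatingMap.smul_apply, coordForm_apply_single, smul_eq_mul]
    simp only [reduceCtorEq, Sum.inl.injEq, Sum.inr.injEq, Fin.isValue, zero_ne_one, one_ne_zero,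
      if_true, if_false]
    push_cast
  · rw [h24]; ring
  · rw [h13]; ring
  · rw [h14]; ring

/-- **`T_{A_N} = ℤε₃₁ ⊕ ℤε₂₄ ⊕ ℤ(ε₂₃ + Nε₁₄)`** (`τ` without complex multiplication, `N ≥ 1`): the transcendental
lattice of `A_N = E_{Nτ} × E_τ` has rank `3 = 6 - ρ(A_N)` with this explicit basis.
[cite: Ma2011DecompositionsAbelianSurface, §4.1 (4.1)] [cite: ShiodaMitani1974, §3 (3.9)] -/
theorem mem_transcendentalLattice_natCast_mul_iff_exists (hq : ∀ p q : ℚ, τ ^ 2 + p * τ + q ≠ 0)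
    {t : (ℂ × ℂ) [⋀^Fin 2]→L[ℝ] ℂ} :
    t ∈ transcendentalLattice (prodPeriod (ellipticPeriod hNτ) (ellipticPeriod hτ)) ↔
      ∃ m₁ m₂ m₃ : ℤ, t = m₁ • coordForm (prodPeriod (ellipticPeriod hNτ) (ellipticPeriod hτ)) (Sum.inr 0) (Sum.inl 0) +
        m₂ • coordForm (prodPeriod (ellipticPeriod hNτ) (ellipticPeriod hτ)) (Sum.inl 1) (Sum.inr 1) +
        m₃ • (coordForm (prodPeriod (ellipticPeriod hNτ) (ellipticPeriod hτ)) (Sum.inl 1) (Sum.inr 0) +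
          (N : ℂ) • coordForm (prodPeriod (ellipticPeriod hNτ) (ellipticPeriod hτ)) (Sum.inl 0) (Sum.inr 1)) := by
  constructor
  · intro ht
    obtain ⟨m₁, h₁⟩ := exists_int_apply_single_of_mem_integralForms _ ht.1 (Sum.inl 0) (Sum.inr 0)
    obtain ⟨m₂, h₂⟩ := exists_int_apply_single_of_mem_integralForms _ ht.1 (Sum.inl 1) (Sum.inr 1)
    obtain ⟨m₃, h₃⟩ := exists_int_apply_single_of_mem_integralForms _ ht.1 (Sum.inl 1) (Sum.inr 0)
    refine ⟨-m₁, m₂, m₃, ?_⟩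
    rw [zsmul_eq_cast_smul₄, zsmul_eq_cast_smul₄, zsmul_eq_cast_smul₄, Int.cast_neg, ← h₁, ← h₂, ← h₃]
    exact eq_combination_of_mem_transcendentalLattice_natCast_mul hτ hNτ ht
  · rintro ⟨m₁, m₂, m₃, rfl⟩
    obtain ⟨g₁, g₂, g₃⟩ := mem_transcendentalLattice_natCast_mul hτ hNτ hq
    exact (transcendentalLattice _).add_mem ((transcendentalLattice _).add_mem
      ((transcendentalLattice _).zsmul_mem g₁ _) ((transcendentalLattice _).zsmul_mem g₂ _))
      ((transcendentalLattice _).zsmul_mem g₃ _)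

/-- The coefficients in `T_{A_N} = ℤε₃₁ ⊕ ℤε₂₄ ⊕ ℤ(ε₂₃ + Nε₁₄)` are unique: the three classes are linearly
independent (test against `(λ₁,λ₃)`, `(λ₂,λ₄)`, `(λ₂,λ₃)`). [cite: Ma2011DecompositionsAbelianSurface, §4.1 (4.1)] -/
theorem independent_transcendental_natCast_mul {m₁ m₂ m₃ : ℂ}
    (h : m₁ • coordForm (prodPeriod (ellipticPeriod hNτ) (ellipticPeriod hτ)) (Sum.inr 0) (Sum.inl 0) +
        m₂ • coordForm (prodPeriod (ellipticPeriod hNτ) (ellipticPeriod hτ)) (Sum.inl 1) (Sum.inr 1) +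
        m₃ • (coordForm (prodPeriod (ellipticPeriod hNτ) (ellipticPeriod hτ)) (Sum.inl 1) (Sum.inr 0) +
          (N : ℂ) • coordForm (prodPeriod (ellipticPeriod hNτ) (ellipticPeriod hτ)) (Sum.inl 0) (Sum.inr 1)) = 0) :
    m₁ = 0 ∧ m₂ = 0 ∧ m₃ = 0 := by
  have ev := fun x y : Fin 2 ⊕ Fin 2 ↦ congrArg (fun δ : (ℂ × ℂ) [⋀^Fin 2]→L[ℝ] ℂ ↦
    δ ![prodPeriod (ellipticPeriod hNτ) (ellipticPeriod hτ) (Pi.single x 1),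
        prodPeriod (ellipticPeriod hNτ) (ellipticPeriod hτ) (Pi.single y 1)]) h
  have e13 := ev (Sum.inl 0) (Sum.inr 0)
  have e24 := ev (Sum.inl 1) (Sum.inr 1)
  have e23 := ev (Sum.inl 1) (Sum.inr 0)
  simp only [ContinuousAlternatingMap.add_apply, ContinuousAlternatingMap.smul_apply,
    ContinuousAlternatingMap.coe_zero, Pi.zero_apply, coordForm_apply_single, smul_eq_mul] at e13 e24 e23
  simp only [reduceCtorEq, Sum.inl.injEq, Sum.inr.injEq, Fin.isValue, zero_ne_one, one_ne_zero,
    if_true, if_false] at e13 e24 e23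
  push_cast at e13 e24 e23
  exact ⟨by linear_combination -e13, by linear_combination e24, by linear_combination e23⟩

/-- **The Gram matrix of `(ε₃₁, ε₂₄, ε₂₃ + Nε₁₄)` is `±(U ⊕ ⟨2N⟩)`**, the sign being the orientation sign of the
frame: `ε₃₁·ε₂₄ = ±1` (Shioda–Mitani's `u¹² ∧ u³⁴ = 1`), `(ε₂₃ + Nε₁₄)² = ±2N`, all other products `0`
(for ANY `τ ∉ ℝ`). [cite: Ma2011DecompositionsAbelianSurface, §4.1 (4.1)] [cite: ShiodaMitani1974, §1 (1.5), §3 (after (3.6))] -/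
theorem torusIntegral_gram_transcendental_natCast_mul :
    torusIntegral (prodPeriod (ellipticPeriod hNτ) (ellipticPeriod hτ)) enum
        ((coordForm (prodPeriod (ellipticPeriod hNτ) (ellipticPeriod hτ)) (Sum.inr 0) (Sum.inl 0)).wedge
          (coordForm (prodPeriod (ellipticPeriod hNτ) (ellipticPeriod hτ)) (Sum.inr 0) (Sum.inl 0))) = 0 ∧
      torusIntegral (prodPeriod (ellipticPeriod hNτ) (ellipticPeriod hτ)) enum
        ((coordForm (prodPeriod (ellipticPeriod hNτ) (ellipticPeriod hτ)) (Sum.inr 0) (Sum.inl 0)).wedge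
          (coordForm (prodPeriod (ellipticPeriod hNτ) (ellipticPeriod hτ)) (Sum.inl 1) (Sum.inr 1))) =
        orientationSign (prodPeriod (ellipticPeriod hNτ) (ellipticPeriod hτ)) enum ∧
      torusIntegral (prodPeriod (ellipticPeriod hNτ) (ellipticPeriod hτ)) enum
        ((coordForm (prodPeriod (ellipticPeriod hNτ) (ellipticPeriod hτ)) (Sum.inr 0) (Sum.inl 0)).wedge
          (coordForm (prodPeriod (ellipticPeriod hNτ) (ellipticPeriod hτ)) (Sum.inl 1) (Sum.inr 0) +
            (N : ℂ) • coordForm (prodPeriod (ellipticPeriod hNτ) (ellipticPeriod hτ)) (Sum.inl 0) (Sum.inr 1))) = 0 ∧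
      torusIntegral (prodPeriod (ellipticPeriod hNτ) (ellipticPeriod hτ)) enum
        ((coordForm (prodPeriod (ellipticPeriod hNτ) (ellipticPeriod hτ)) (Sum.inl 1) (Sum.inr 1)).wedge
          (coordForm (prodPeriod (ellipticPeriod hNτ) (ellipticPeriod hτ)) (Sum.inl 1) (Sum.inr 1))) = 0 ∧
      torusIntegral (prodPeriod (ellipticPeriod hNτ) (ellipticPeriod hτ)) enum
        ((coordForm (prodPeriod (ellipticPeriod hNτ) (ellipticPeriod hτ)) (Sum.inl 1) (Sum.inr 1)).wedge
          (coordForm (prodPeriod (ellipticPeriod hNτ) (ellipticPeriod hτ)) (Sum.inl 1) (Sum.inr 0) +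
            (N : ℂ) • coordForm (prodPeriod (ellipticPeriod hNτ) (ellipticPeriod hτ)) (Sum.inl 0) (Sum.inr 1))) = 0 ∧
      torusIntegral (prodPeriod (ellipticPeriod hNτ) (ellipticPeriod hτ)) enum
        ((coordForm (prodPeriod (ellipticPeriod hNτ) (ellipticPeriod hτ)) (Sum.inl 1) (Sum.inr 0) +
            (N : ℂ) • coordForm (prodPeriod (ellipticPeriod hNτ) (ellipticPeriod hτ)) (Sum.inl 0) (Sum.inr 1)).wedge
          (coordForm (prodPeriod (ellipticPeriod hNτ) (ellipticPeriod hτ)) (Sum.inl 1) (Sum.inr 0) +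
            (N : ℂ) • coordForm (prodPeriod (ellipticPeriod hNτ) (ellipticPeriod hτ)) (Sum.inl 0) (Sum.inr 1))) =
        orientationSign (prodPeriod (ellipticPeriod hNτ) (ellipticPeriod hτ)) enum * (2 * (N : ℂ)) := by
  refine ⟨?_, ?_, ?_, ?_, ?_, ?_⟩
  all_goals
    rw [torusIntegral_wedge_two_two]
    simp only [enum_zero, enum_one, enum_two, enum_three, ContinuousAlternatingMap.add_apply,
      ContinuousAlternatingMap.smul_apply, coordForm_apply_single, smul_eq_mul]
    simp only [reduceCtorEq, Sum.inl.injEq, Sum.inr.injEq, Fin.isValue, zero_ne_one, one_ne_zero,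
      if_true, if_false]
    push_cast
    ring

/-! ## §3 In the upper half plane: the Gram matrices are EXACTLY `U ⊕ ⟨-2N⟩` and `U ⊕ ⟨2N⟩`;
`N = ½ det NS_A = -½ det T_A` (Ma (4.1)) -/

/-- **`NS_{A_N} ≅ U ⊕ ⟨-2N⟩` on the nose**: for `Im τ > 0` the frame `((Nτ,0),(1,0),(0,τ),(0,1))` is positively
oriented and the Gram matrix of the basis `(ε₁₂, ε₃₄, ε₂₃ - Nε₁₄)` of `S_{A_N}` for the cup product (1.5) is exactly
`((0,1,0),(1,0,0),(0,0,-2N))`. [cite: Ma2011DecompositionsAbelianSurface, §4.1 (`NS_A ≅ U ⊕ ⟨-2N⟩`, (4.1))] -/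
theorem gram_neronSeveri_natCast_mul {τ : ℂ} (hτ : 0 < τ.im) {N : ℕ} (hNτ : 0 < ((N : ℂ) * τ).im) :
    torusIntegral (prodPeriod (ellipticPeriod hNτ.ne') (ellipticPeriod hτ.ne')) enum
        ((coordForm (prodPeriod (ellipticPeriod hNτ.ne') (ellipticPeriod hτ.ne')) (Sum.inl 0) (Sum.inl 1)).wedge
          (coordForm (prodPeriod (ellipticPeriod hNτ.ne') (ellipticPeriod hτ.ne')) (Sum.inl 0) (Sum.inl 1))) = 0 ∧
      torusIntegral (prodPeriod (ellipticPeriod hNτ.ne') (ellipticPeriod hτ.ne')) enum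
        ((coordForm (prodPeriod (ellipticPeriod hNτ.ne') (ellipticPeriod hτ.ne')) (Sum.inl 0) (Sum.inl 1)).wedge
          (coordForm (prodPeriod (ellipticPeriod hNτ.ne') (ellipticPeriod hτ.ne')) (Sum.inr 0) (Sum.inr 1))) = 1 ∧
      torusIntegral (prodPeriod (ellipticPeriod hNτ.ne') (ellipticPeriod hτ.ne')) enum
        ((coordForm (prodPeriod (ellipticPeriod hNτ.ne') (ellipticPeriod hτ.ne')) (Sum.inl 0) (Sum.inl 1)).wedge
          (coordForm (prodPeriod (ellipticPeriod hNτ.ne') (ellipticPeriod hτ.ne')) (Sum.inl 1) (Sum.inr 0) -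
            (N : ℂ) • coordForm (prodPeriod (ellipticPeriod hNτ.ne') (ellipticPeriod hτ.ne')) (Sum.inl 0) (Sum.inr 1))) = 0 ∧
      torusIntegral (prodPeriod (ellipticPeriod hNτ.ne') (ellipticPeriod hτ.ne')) enum
        ((coordForm (prodPeriod (ellipticPeriod hNτ.ne') (ellipticPeriod hτ.ne')) (Sum.inr 0) (Sum.inr 1)).wedge
          (coordForm (prodPeriod (ellipticPeriod hNτ.ne') (ellipticPeriod hτ.ne')) (Sum.inr 0) (Sum.inr 1))) = 0 ∧
      torusIntegral (prodPeriod (ellipticPeriod hNτ.ne') (ellipticPeriod hτ.ne')) enum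
        ((coordForm (prodPeriod (ellipticPeriod hNτ.ne') (ellipticPeriod hτ.ne')) (Sum.inr 0) (Sum.inr 1)).wedge
          (coordForm (prodPeriod (ellipticPeriod hNτ.ne') (ellipticPeriod hτ.ne')) (Sum.inl 1) (Sum.inr 0) -
            (N : ℂ) • coordForm (prodPeriod (ellipticPeriod hNτ.ne') (ellipticPeriod hτ.ne')) (Sum.inl 0) (Sum.inr 1))) = 0 ∧
      torusIntegral (prodPeriod (ellipticPeriod hNτ.ne') (ellipticPeriod hτ.ne')) enum
        ((coordForm (prodPeriod (ellipticPeriod hNτ.ne') (ellipticPeriod hτ.ne')) (Sum.inl 1) (Sum.inr 0) -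
            (N : ℂ) • coordForm (prodPeriod (ellipticPeriod hNτ.ne') (ellipticPeriod hτ.ne')) (Sum.inl 0) (Sum.inr 1)).wedge
          (coordForm (prodPeriod (ellipticPeriod hNτ.ne') (ellipticPeriod hτ.ne')) (Sum.inl 1) (Sum.inr 0) -
            (N : ℂ) • coordForm (prodPeriod (ellipticPeriod hNτ.ne') (ellipticPeriod hτ.ne')) (Sum.inl 0) (Sum.inr 1))) =
        -(2 * (N : ℂ)) := by
  obtain ⟨h11, h12, h13, h22, h23, h33⟩ := torusIntegral_gram_neronSeveri_natCast_mul hτ.ne' hNτ.ne'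
  rw [h11, h12, h13, h22, h23, h33, orientationSign_enum hNτ hτ]
  simp

/-- **`T_{A_N} ≅ U ⊕ ⟨2N⟩` on the nose, so `det T_{A_N} = -2N`**: for `Im τ > 0` the Gram matrix of the basis
`(ε₃₁, ε₂₄, ε₂₃ + Nε₁₄)` of `T_{A_N}` for the cup product (1.5) is exactly `((0,1,0),(1,0,0),(0,0,2N))` — the `N` of
Ma's Theorems 1.2 (2), 1.3 (2) "where `2N = -det(T_A)`" for the normal form `A_N = E_{Nτ} × E_τ`.
[cite: Ma2011DecompositionsAbelianSurface, §1 Thm. 1.2 (2), Thm. 1.3 (2) and §4.1 (4.1)] -/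
theorem gram_transcendental_natCast_mul {τ : ℂ} (hτ : 0 < τ.im) {N : ℕ} (hNτ : 0 < ((N : ℂ) * τ).im) :
    torusIntegral (prodPeriod (ellipticPeriod hNτ.ne') (ellipticPeriod hτ.ne')) enum
        ((coordForm (prodPeriod (ellipticPeriod hNτ.ne') (ellipticPeriod hτ.ne')) (Sum.inr 0) (Sum.inl 0)).wedge
          (coordForm (prodPeriod (ellipticPeriod hNτ.ne') (ellipticPeriod hτ.ne')) (Sum.inr 0) (Sum.inl 0))) = 0 ∧
      torusIntegral (prodPeriod (ellipticPeriod hNτ.ne') (ellipticPeriod hτ.ne')) enum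
        ((coordForm (prodPeriod (ellipticPeriod hNτ.ne') (ellipticPeriod hτ.ne')) (Sum.inr 0) (Sum.inl 0)).wedge
          (coordForm (prodPeriod (ellipticPeriod hNτ.ne') (ellipticPeriod hτ.ne')) (Sum.inl 1) (Sum.inr 1))) = 1 ∧
      torusIntegral (prodPeriod (ellipticPeriod hNτ.ne') (ellipticPeriod hτ.ne')) enum
        ((coordForm (prodPeriod (ellipticPeriod hNτ.ne') (ellipticPeriod hτ.ne')) (Sum.inr 0) (Sum.inl 0)).wedge
          (coordForm (prodPeriod (ellipticPeriod hNτ.ne') (ellipticPeriod hτ.ne')) (Sum.inl 1) (Sum.inr 0) +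
            (N : ℂ) • coordForm (prodPeriod (ellipticPeriod hNτ.ne') (ellipticPeriod hτ.ne')) (Sum.inl 0) (Sum.inr 1))) = 0 ∧
      torusIntegral (prodPeriod (ellipticPeriod hNτ.ne') (ellipticPeriod hτ.ne')) enum
        ((coordForm (prodPeriod (ellipticPeriod hNτ.ne') (ellipticPeriod hτ.ne')) (Sum.inl 1) (Sum.inr 1)).wedge
          (coordForm (prodPeriod (ellipticPeriod hNτ.ne') (ellipticPeriod hτ.ne')) (Sum.inl 1) (Sum.inr 1))) = 0 ∧
      torusIntegral (prodPeriod (ellipticPeriod hNτ.ne') (ellipticPeriod hτ.ne')) enum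
        ((coordForm (prodPeriod (ellipticPeriod hNτ.ne') (ellipticPeriod hτ.ne')) (Sum.inl 1) (Sum.inr 1)).wedge
          (coordForm (prodPeriod (ellipticPeriod hNτ.ne') (ellipticPeriod hτ.ne')) (Sum.inl 1) (Sum.inr 0) +
            (N : ℂ) • coordForm (prodPeriod (ellipticPeriod hNτ.ne') (ellipticPeriod hτ.ne')) (Sum.inl 0) (Sum.inr 1))) = 0 ∧
      torusIntegral (prodPeriod (ellipticPeriod hNτ.ne') (ellipticPeriod hτ.ne')) enum
        ((coordForm (prodPeriod (ellipticPeriod hNτ.ne') (ellipticPeriod hτ.ne')) (Sum.inl 1) (Sum.inr 0) +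
            (N : ℂ) • coordForm (prodPeriod (ellipticPeriod hNτ.ne') (ellipticPeriod hτ.ne')) (Sum.inl 0) (Sum.inr 1)).wedge
          (coordForm (prodPeriod (ellipticPeriod hNτ.ne') (ellipticPeriod hτ.ne')) (Sum.inl 1) (Sum.inr 0) +
            (N : ℂ) • coordForm (prodPeriod (ellipticPeriod hNτ.ne') (ellipticPeriod hτ.ne')) (Sum.inl 0) (Sum.inr 1))) =
        2 * (N : ℂ) := by
  obtain ⟨h11, h12, h13, h22, h23, h33⟩ := torusIntegral_gram_transcendental_natCast_mul hτ.ne' hNτ.ne'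
  rw [h11, h12, h13, h22, h23, h33, orientationSign_enum hNτ hτ]
  simp

/-- **Ma's (4.1): `N = ½ det(NS_A) = -½ det(T_A)`** for the two Gram matrices `U ⊕ ⟨-2N⟩` and `U ⊕ ⟨2N⟩`:
`det ((0,1,0),(1,0,0),(0,0,-2N)) = 2N` and `det ((0,1,0),(1,0,0),(0,0,2N)) = -2N`.
[cite: Ma2011DecompositionsAbelianSurface, §4.1 (4.1)] -/
theorem det_gram_neronSeveri_transcendental (N : ℤ) :
    Matrix.det !![(0 : ℤ), 1, 0; 1, 0, 0; 0, 0, -(2 * N)] = 2 * N ∧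
      Matrix.det !![(0 : ℤ), 1, 0; 1, 0, 0; 0, 0, 2 * N] = -(2 * N) := by
  constructor <;> simp [Matrix.det_fin_three]

end NormalForm

/-! ## §4 The cup product on `2`-classes of a surface is symmetric -/

section Symmetric

variable {ι : Type*} [Fintype ι] [DecidableEq ι] {E : Type*} [NormedAddCommGroup E] [NormedSpace ℂ E]
  (Φ : (ι → ℝ) ≃L[ℝ] E) (e : Fin (2 + 2) ≃ ι)

omit [Fintype ι] in
/-- **The cup product `H² × H² → H⁴ = ℤ` of a two-dimensional torus is symmetric**: `∫_X β ∧ γ = ∫_X γ ∧ β` for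
`2`-classes (so the six upper-triangular Gram values of a basis determine the Gram matrix).
[cite: ShiodaMitani1974, §1 (1.5) ("a Euclidean lattice")] -/
theorem torusIntegral_wedge_two_comm (β γ : E [⋀^Fin 2]→L[ℝ] ℂ) :
    torusIntegral Φ e (β.wedge γ) = torusIntegral Φ e (γ.wedge β) := by
  rw [torusIntegral_wedge_two_two, torusIntegral_wedge_two_two]
  ring

end Symmetric

/-! ## §5 Transport: every two-dimensional torus `X ≅ A_N` has `NS_X ≅ U ⊕ ⟨-2N⟩`, `T_X ≅ U ⊕ ⟨2N⟩`, and — for this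
`N` — `δ̃(X) = 2^{τ(N)}` (`N > 1`), `1` (`N = 1`), `δ(X) = 2^{τ(N)-1}` (Theorems 1.3 (2), 1.2 (2) with "`2N = -det T_X`") -/

section Transport

variable {ι : Type*} [Fintype ι] [DecidableEq ι] {E : Type*} [NormedAddCommGroup E] [NormedSpace ℂ E]
  {Φ : (ι → ℝ) ≃L[ℝ] E}

omit [Fintype ι] [DecidableEq ι] in
/-- Transport of a rank-`3` description `L′ = ℤw₁ ⊕ ℤw₂ ⊕ ℤw₃` (membership and independence) along an injective
`ℂ`-linear `Ψ` with `Ψ L′ = L`. [cite: ShiodaMitani1974, §3 (3.19)] -/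
private theorem transport_basis₃ {E' : Type*} [NormedAddCommGroup E'] [NormedSpace ℂ E']
    (Ψ : (E' [⋀^Fin 2]→L[ℝ] ℂ) →ₗ[ℂ] (E [⋀^Fin 2]→L[ℝ] ℂ)) (hinj : Function.Injective Ψ)
    {L' : AddSubgroup (E' [⋀^Fin 2]→L[ℝ] ℂ)} {L : AddSubgroup (E [⋀^Fin 2]→L[ℝ] ℂ)}
    (hL : L'.map Ψ.toAddMonoidHom = L) {w₁ w₂ w₃ : E' [⋀^Fin 2]→L[ℝ] ℂ}
    (hmem : ∀ t, t ∈ L' ↔ ∃ n₁ n₂ n₃ : ℤ, t = n₁ • w₁ + n₂ • w₂ + n₃ • w₃)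
    (hind : ∀ n₁ n₂ n₃ : ℂ, n₁ • w₁ + n₂ • w₂ + n₃ • w₃ = 0 → n₁ = 0 ∧ n₂ = 0 ∧ n₃ = 0) :
    (∀ t, t ∈ L ↔ ∃ n₁ n₂ n₃ : ℤ, t = n₁ • Ψ w₁ + n₂ • Ψ w₂ + n₃ • Ψ w₃) ∧
      ∀ n₁ n₂ n₃ : ℂ, n₁ • Ψ w₁ + n₂ • Ψ w₂ + n₃ • Ψ w₃ = 0 → n₁ = 0 ∧ n₂ = 0 ∧ n₃ = 0 := by
  refine ⟨fun t ↦ ?_, fun n₁ n₂ n₃ h ↦ hind n₁ n₂ n₃ (hinj ?_)⟩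
  · rw [← hL, AddSubgroup.mem_map]
    constructor
    · rintro ⟨t', ht', rfl⟩
      obtain ⟨n₁, n₂, n₃, rfl⟩ := (hmem t').1 ht'
      exact ⟨n₁, n₂, n₃, by simp [map_zsmul]⟩
    · rintro ⟨n₁, n₂, n₃, rfl⟩
      exact ⟨n₁ • w₁ + n₂ • w₂ + n₃ • w₃, (hmem _).2 ⟨n₁, n₂, n₃, rfl⟩, by simp [map_zsmul]⟩
  · rw [map_add, map_add, map_smul, map_smul, map_smul, h, map_zero]

/-- For `n = 1`, `E_{nτ} ≅ E_τ` (a cast identity). [folklore] -/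
private theorem isIsomorphic_ellipticPeriod_natCast_one_mul' {τ : ℂ} {n : ℕ} (hn : n = 1)
    (h : ((n : ℂ) * τ).im ≠ 0) (hτ : τ.im ≠ 0) : IsIsomorphic (ellipticPeriod h) (ellipticPeriod hτ) := by
  subst hn
  have e : ((1 : ℕ) : ℂ) * τ = τ := by rw [Nat.cast_one, one_mul]
  revert h
  rw [e]
  exact fun h ↦ IsIsomorphic.refl _

/-- **MA §4.1 TRANSPORTED: every two-dimensional complex torus `X ≅ A_N = E_{Nτ} × E_τ` (`τ ∈ ℍ` without complex
multiplication, `N ≥ 1`) has `NS_X ≅ U ⊕ ⟨-2N⟩` and `T_X ≅ U ⊕ ⟨2N⟩`** — so `N = ½ det(NS_X) = -½ det(T_X)` (4.1).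
Here `X = E/Φ(ℤ^ι)` with an ordering `e` of its lattice basis (the datum of `∫_X`), `NS_X = integralHodgeClasses Φ 1`,
`T_X = transcendentalLattice Φ`, the pairing is the cup product `∫_X x ∧ y`; each lattice comes with an explicit
`ℤ`-basis, uniqueness of coefficients and its Gram values (upper triangle; the pairing is symmetric, §4).  By FILE 3
(`exists_normalForm_of_finrank_neronSeveriGroup_eq_three`) every decomposable `X` with `ρ(X) = 3` is of this form,
with `N` the minimal isogeny degree between the factors (Prop. 4.1).
[cite: Ma2011DecompositionsAbelianSurface, §4.1 (`NS_A ≅ U ⊕ ⟨-2N⟩`) and (4.1)] [cite: ShiodaMitani1974, §3 (3.19) (transport along isomorphisms)] -/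
theorem neronSeveri_transcendental_gram_of_isIsomorphic_natCast_mul (e : Fin (2 + 2) ≃ ι) {τ : ℂ} (hτ : 0 < τ.im)
    (hq : ∀ p q : ℚ, τ ^ 2 + p * τ + q ≠ 0) {N : ℕ} (hNτ : 0 < ((N : ℂ) * τ).im)
    (hX : IsIsomorphic Φ (prodPeriod (ellipticPeriod hNτ.ne') (ellipticPeriod hτ.ne'))) :
    (∃ v₁ v₂ v₃ : E [⋀^Fin 2]→L[ℝ] ℂ,
        (∀ s, s ∈ integralHodgeClasses Φ 1 ↔ ∃ n₁ n₂ n₃ : ℤ, s = n₁ • v₁ + n₂ • v₂ + n₃ • v₃) ∧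
        (∀ n₁ n₂ n₃ : ℂ, n₁ • v₁ + n₂ • v₂ + n₃ • v₃ = 0 → n₁ = 0 ∧ n₂ = 0 ∧ n₃ = 0) ∧
        torusIntegral Φ e (v₁.wedge v₁) = 0 ∧ torusIntegral Φ e (v₁.wedge v₂) = 1 ∧
        torusIntegral Φ e (v₁.wedge v₃) = 0 ∧ torusIntegral Φ e (v₂.wedge v₂) = 0 ∧
        torusIntegral Φ e (v₂.wedge v₃) = 0 ∧ torusIntegral Φ e (v₃.wedge v₃) = -(2 * (N : ℂ))) ∧
      ∃ u₁ u₂ u₃ : E [⋀^Fin 2]→L[ℝ] ℂ,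
        (∀ t, t ∈ transcendentalLattice Φ ↔ ∃ n₁ n₂ n₃ : ℤ, t = n₁ • u₁ + n₂ • u₂ + n₃ • u₃) ∧
        (∀ n₁ n₂ n₃ : ℂ, n₁ • u₁ + n₂ • u₂ + n₃ • u₃ = 0 → n₁ = 0 ∧ n₂ = 0 ∧ n₃ = 0) ∧
        torusIntegral Φ e (u₁.wedge u₁) = 0 ∧ torusIntegral Φ e (u₁.wedge u₂) = 1 ∧
        torusIntegral Φ e (u₁.wedge u₃) = 0 ∧ torusIntegral Φ e (u₂.wedge u₂) = 0 ∧
        torusIntegral Φ e (u₂.wedge u₃) = 0 ∧ torusIntegral Φ e (u₃.wedge u₃) = 2 * (N : ℂ) := by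
  obtain ⟨Ψ, hinj, -, hS, hT, hint⟩ := hX.exists_transcendentalLattice_transport e enum
  obtain ⟨s11, s12, s13, s22, s23, s33⟩ := gram_neronSeveri_natCast_mul hτ hNτ
  obtain ⟨t11, t12, t13, t22, t23, t33⟩ := gram_transcendental_natCast_mul hτ hNτ
  obtain ⟨hSmem, hSind⟩ := transport_basis₃ Ψ hinj hS
    (fun s ↦ mem_integralHodgeClasses_natCast_mul_iff_exists hτ.ne' hNτ.ne' hq)
    (fun n₁ n₂ n₃ h ↦ independent_neronSeveri_natCast_mul hτ.ne' hNτ.ne' h)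
  obtain ⟨hTmem, hTind⟩ := transport_basis₃ Ψ hinj hT
    (fun t ↦ mem_transcendentalLattice_natCast_mul_iff_exists hτ.ne' hNτ.ne' hq)
    (fun n₁ n₂ n₃ h ↦ independent_transcendental_natCast_mul hτ.ne' hNτ.ne' h)
  refine ⟨⟨_, _, _, hSmem, hSind, ?_, ?_, ?_, ?_, ?_, ?_⟩, ⟨_, _, _, hTmem, hTind, ?_, ?_, ?_, ?_, ?_, ?_⟩⟩
  · rw [hint, s11]
  · rw [hint, s12]
  · rw [hint, s13]
  · rw [hint, s22]
  · rw [hint, s23]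
  · rw [hint, s33]
  · rw [hint, t11]
  · rw [hint, t12]
  · rw [hint, t13]
  · rw [hint, t22]
  · rw [hint, t23]
  · rw [hint, t33]

/-- **MA, THEOREMS 1.3 (2) AND 1.2 (2) WITH "`2N = -det(T_A)`", for every two-dimensional torus `X ≅ A_N`**
(`τ ∈ ℍ` without complex multiplication, `N ≥ 1`): `T_X ≅ U ⊕ ⟨2N⟩` — an explicit `ℤ`-basis `u₁, u₂, u₃` of the
transcendental lattice with `u₁u₂ = 1`, `u₃² = 2N`, all other products `0` — and, for THIS `N`,
**`δ̃(X) = 2^{τ(N)}` (`N > 1`), `= 1` (`N = 1`)**: the decompositions `E_{ω₁} × E_{ω₂} ≅ X` up to strict isomorphism are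
represented by a set `Dec` of period pairs with `#Dec = 2 ^ #(prime factors of N)`, and **`δ(X) = 2^{τ(N)-1}`**
(`τ(1) := 1`; truncated subtraction): those up to interchanging the factors by `DecU` with
`#DecU = 2 ^ (#(prime factors of N) - 1)` (FILE 2's counts for `A_N`, transported).  With FILE 3's normal form this is
Theorem 1.3 (2) / 1.2 (2) for every decomposable `X` with `ρ(X) = 3`.
[cite: Ma2011DecompositionsAbelianSurface, §1 Thm. 1.2 (2), Thm. 1.3 (2) ("where `2N = -det(T_A)`"), §4.1 (4.1), Prop. 4.2, §4.2 Thm. 4.6] -/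
theorem card_decompositions_of_isIsomorphic_natCast_mul_transcendentalLattice (e : Fin (2 + 2) ≃ ι) {τ : ℂ}
    (hτ : 0 < τ.im) (hq : ∀ p q : ℚ, τ ^ 2 + p * τ + q ≠ 0) {N : ℕ} (hN : 0 < N) (hNτ : 0 < ((N : ℂ) * τ).im)
    (hX : IsIsomorphic Φ (prodPeriod (ellipticPeriod hNτ.ne') (ellipticPeriod hτ.ne'))) :
    (∃ u₁ u₂ u₃ : E [⋀^Fin 2]→L[ℝ] ℂ,
        (∀ t, t ∈ transcendentalLattice Φ ↔ ∃ n₁ n₂ n₃ : ℤ, t = n₁ • u₁ + n₂ • u₂ + n₃ • u₃) ∧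
        (∀ n₁ n₂ n₃ : ℂ, n₁ • u₁ + n₂ • u₂ + n₃ • u₃ = 0 → n₁ = 0 ∧ n₂ = 0 ∧ n₃ = 0) ∧
        torusIntegral Φ e (u₁.wedge u₁) = 0 ∧ torusIntegral Φ e (u₁.wedge u₂) = 1 ∧
        torusIntegral Φ e (u₁.wedge u₃) = 0 ∧ torusIntegral Φ e (u₂.wedge u₂) = 0 ∧
        torusIntegral Φ e (u₂.wedge u₃) = 0 ∧ torusIntegral Φ e (u₃.wedge u₃) = 2 * (N : ℂ)) ∧
      (∃ Dec : Finset (ℂ × ℂ), Dec.card = 2 ^ N.primeFactors.card ∧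
        (∀ p ∈ Dec, ∃ (h₁ : 0 < p.1.im) (h₂ : 0 < p.2.im),
          IsIsomorphic (prodPeriod (ellipticPeriod h₁.ne') (ellipticPeriod h₂.ne')) Φ) ∧
        ∀ (ω₁ ω₂ : ℂ) (hω₁ : 0 < ω₁.im) (hω₂ : 0 < ω₂.im),
          IsIsomorphic (prodPeriod (ellipticPeriod hω₁.ne') (ellipticPeriod hω₂.ne')) Φ →
          ∃! p, p ∈ Dec ∧ ∃ (h₁ : 0 < p.1.im) (h₂ : 0 < p.2.im),
            IsIsomorphic (ellipticPeriod hω₁.ne') (ellipticPeriod h₁.ne') ∧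
              IsIsomorphic (ellipticPeriod hω₂.ne') (ellipticPeriod h₂.ne')) ∧
      ∃ DecU : Finset (ℂ × ℂ), DecU.card = 2 ^ (N.primeFactors.card - 1) ∧
        (∀ p ∈ DecU, ∃ (h₁ : 0 < p.1.im) (h₂ : 0 < p.2.im),
          IsIsomorphic (prodPeriod (ellipticPeriod h₁.ne') (ellipticPeriod h₂.ne')) Φ) ∧
        ∀ (ω₁ ω₂ : ℂ) (hω₁ : 0 < ω₁.im) (hω₂ : 0 < ω₂.im),
          IsIsomorphic (prodPeriod (ellipticPeriod hω₁.ne') (ellipticPeriod hω₂.ne')) Φ →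
          ∃! p, p ∈ DecU ∧ ∃ (h₁ : 0 < p.1.im) (h₂ : 0 < p.2.im),
            (IsIsomorphic (ellipticPeriod hω₁.ne') (ellipticPeriod h₁.ne') ∧
                IsIsomorphic (ellipticPeriod hω₂.ne') (ellipticPeriod h₂.ne')) ∨
              (IsIsomorphic (ellipticPeriod hω₁.ne') (ellipticPeriod h₂.ne') ∧
                IsIsomorphic (ellipticPeriod hω₂.ne') (ellipticPeriod h₁.ne')) := by
  obtain ⟨-, hTX⟩ := neronSeveri_transcendental_gram_of_isIsomorphic_natCast_mul e hτ hq hNτ hX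
  obtain ⟨Dec, hcard, hmem, huniq⟩ := card_decompositions_natCast_mul hτ hq hNτ
  refine ⟨hTX, ⟨Dec, hcard, fun p hp ↦ ?_, fun ω₁ ω₂ hω₁ hω₂ hiso ↦ huniq ω₁ ω₂ hω₁ hω₂ (hiso.trans hX)⟩, ?_⟩
  · obtain ⟨h₁, h₂, hiso⟩ := hmem p hp
    exact ⟨h₁, h₂, hiso.trans hX.symm⟩
  · rcases Nat.lt_or_ge 1 N with hlt | hle
    · obtain ⟨DecU, hcardU, hmemU, huniqU⟩ := card_decompositions_up_to_swap_natCast_mul hτ hq hlt hNτ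
      refine ⟨DecU, hcardU, fun p hp ↦ ?_, fun ω₁ ω₂ hω₁ hω₂ hiso ↦ huniqU ω₁ ω₂ hω₁ hω₂ (hiso.trans hX)⟩
      obtain ⟨h₁, h₂, hiso⟩ := hmemU p hp
      exact ⟨h₁, h₂, hiso.trans hX.symm⟩
    · -- `N = 1`: `X ≅ E_τ × E_τ`
      have h1 : N = 1 := le_antisymm hle hN
      have hX' : IsIsomorphic Φ (prodPeriod (ellipticPeriod hτ.ne') (ellipticPeriod hτ.ne')) :=
        hX.trans ((isIsomorphic_ellipticPeriod_natCast_one_mul' h1 hNτ.ne' hτ.ne').prod (IsIsomorphic.refl _))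
      obtain ⟨DecU, hcardU, hmemU, huniqU⟩ := card_decompositions_up_to_swap_prod_self hτ hq
      refine ⟨DecU, ?_, fun p hp ↦ ?_, fun ω₁ ω₂ hω₁ hω₂ hiso ↦ huniqU ω₁ ω₂ hω₁ hω₂ (hiso.trans hX')⟩
      · rw [hcardU, h1, Nat.primeFactors_one, Finset.card_empty]
        norm_num
      · obtain ⟨h₁, h₂, hiso⟩ := hmemU p hp
        exact ⟨h₁, h₂, hiso.trans hX'.symm⟩

end Transport


end ComplexTorus

end Literature.Geometry.Kaehler

end
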